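import Summits.HodgeConjecture.HodgeConjecture.Theorems.PadicSemiregularLiftFormalLiftingFromClassLiftingHuTowerAlgebra
import Literature.AlgebraicGeometry.KTheory.HuInfinitesimalKZero

/-!
# `FormalLiftingFromClassLifting` (stmt-HodgeConjecture-13825) · line `hu` · assembly from X. Hu's
# `K₀`-criteria and the two coherent lattice lemmas

Crux P1a of route `PadicSemiregularLift` (`Theses.PadicSemiregularLift.FormalLiftingFromClassLifting`)
is, through the landed glue (`…Glue.liftsFormally_of_stepClassLifting`,
`…Glue.stepClassLifting_of_levelwiseLifts_of_kernelTower`, p76799) and the landed `K₀`-tower algebra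
(`…HuTowerAlgebra.kernelTower_of_naturalSurjections`, `…HuTowerAlgebra.levelwiseLift_of_obstructionData`,
p97334), the conjunction of two `K₀`-statements (2_K) KERNEL TOWER and level-wise (1_K). This file
INSTANTIATES the tower algebra with the two named facts of X. Hu, *On the algebraic K-theory of smooth
schemes over truncated Witt vectors*, arXiv:2507.12458 (2025), vendored in
`Literature/AlgebraicGeometry/KTheory/HuInfinitesimalKZero.lean` as the claims
`KTheory.HuKZeroKernelPresentation` (Cor. 10.5 (i), `i = 0`, + Prop. 9.6 (ii)) and
`KTheory.HuKZeroLiftingCriterion` (Thm. 1.2 = Prop. 11.1 (i) + Prop. 9.6 (i)), and isolates EXACTLY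
the two coherent lattice statements over the tree's carriers (`KTheory.huH p k 𝒳 r m n i =
ℍⁱ(𝒳, p^{r,m}_{r,n}Ω•)`, `KTheory.huHReduce` the reductions in `n`) that remain:

* (S) **odd transitions are onto**: for `1 ≤ r < p` and every `N`,
  `ℍ^{2r-1}(p^{r,1}_{r,N+3}Ω•) → ℍ^{2r-1}(p^{r,1}_{r,N+2}Ω•)` is surjective;
* (T) **even compatible families killed by a non-zero integer vanish**: for `1 ≤ r < d`, a family
  `o_N ∈ ℍ^{2r}(p^{r,1}_{r,N+2}Ω•)` compatible under the reductions with `L • o = 0`, `L ≠ 0`, is zero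
  (i.e. `lim_N ℍ^{2r}` is torsion-free).

Results (sorry-free; the Hu claims enter as HYPOTHESES `(hK : HuKZeroKernelPresentation)`,
`(hL : HuKZeroLiftingCriterion)`, so everything here is a conditional result on those claims):

* `kernelTower_of_huKernelPresentation_of_components` — `hK` + (S) ⇒ (2_K) for `𝒳` (any smooth proper model with
  `d + 5 ≤ p`);
* `levelwiseLift_of_huLiftingCriterion_of_components` — `hL` + (T) ⇒ level-wise (1_K) for `𝒳` (`d + 6 ≤ p`): every
  class on `X_k` a non-zero multiple of which lifts to all levels lifts to all levels;
* `stepClassLifting_of_hu` — both ⇒ step class lifting for every finite-level lift of a finite locally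
  free `E₁` whose rational class pro-lifts (the hypothesis `hstep` of `Glue.liftsFormally_of_stepClassLifting`);
* `formalLiftingFromClassLifting_of_hu` — **the crux by name** from `hK`, `hL` and the lattice
  statements (S), (T) quantified over the crux's models (smooth proper, projective, `d + 6 < p`,
  `p`-torsion-free `H•(𝒳, 𝒪)` and `H•(𝒳, Ω¹)`, `d ≤ 3 ∨ Ω¹ free`), the hypotheses under which the
  lattice lemmas are to be proved (X. Hu, loc. cit., §11; Bloch–Esnault–Kerz, Invent. Math. 195 (2014),
  Rem. 35: degeneration of Hodge–de Rham modulo torsion + torsion-free Hodge cohomology).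

Relation to `…HuReduction.lean` (seat 0, landed minutes earlier): that file performs the same
instantiation with the lattice statements in PRODUCT form (surjectivity of
`KTheory.HuKernelSource.reduce`, torsion families in `KTheory.HuObstructionTarget`); here they are
COMPONENTWISE in `r` (one hypercohomology group `ℍ^{2r-1}` / `ℍ^{2r}` of ONE Hu complex at a time),
the form in which the coherent lattice lemmas are proved, and the (trivial) passage to the product is
done here (`choose` / `funext`).

Nothing here uses properness, projectivity or torsion-freeness: they only flow into (S) and (T).
-/

set_option linter.dupNamespace false

namespace Summit.HodgeConjecture.HodgeConjecture.Theorems.FormalLiftingFromClassLifting.HuLine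

open CategoryTheory AlgebraicGeometry Limits
open Literature.AlgebraicGeometry Literature.AlgebraicGeometry.Motives
open Literature.AlgebraicGeometry.Motives.WittScheme Literature.AlgebraicGeometry.KTheory
open Summit.HodgeConjecture.HodgeConjecture.Theses.PadicSemiregularLift

noncomputable section

section Model

variable {p : ℕ} [Fact p.Prime] {k : Type} [Field k] [CharP k p] [PerfectRing k p] {d : ℕ}
  (𝒳 : SchemeOver (WittVector p k))

/-! ## (2_K) from Hu's kernel presentation and the odd lattice lemma (S) -/

/-- **Kernel tower from Hu's presentation of `ker(K₀(X_n) → K₀(X_1))` and surjective odd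
transitions.** Granted X. Hu's Cor. 10.5 (i) / Prop. 9.6 (ii) (`KTheory.HuKZeroKernelPresentation`, a
claim of arXiv:2507.12458, hypothesis `hK`) for the smooth proper model `𝒳/W(k)` of relative dimension
`d` with `d + 5 ≤ p`, and the coherent lattice statement (S) — the reductions
`ℍ^{2r-1}(p^{r,1}_{r,N+3}Ω•) → ℍ^{2r-1}(p^{r,1}_{r,N+2}Ω•)` are onto for `1 ≤ r < p` — every class on
`X_{n+1}` dying on `X_k` is the restriction of a class on `X_{n+2}` dying on `X_k` (verbatim the
conclusion of the line's stub `stub_kernelTower`). Proof: `HuTowerAlgebra.kernelTower_of_naturalSurjections`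
with `S N = ⊕_{r<p} ℍ^{2r-1}(p^{r,1}_{r,N+2}Ω•)`, `ρ N = ρ_{1,N+2}`, `red N` = the reduction.
[cite: Hu2025TruncatedWitt, Cor. 10.5 (i), Prop. 9.6 (ii)] -/
theorem kernelTower_of_huKernelPresentation_of_components (hK : HuKZeroKernelPresentation)
    (h𝒳 : IsSmoothProperModel d 𝒳) (hp : d + 5 ≤ p)
    (hS : ∀ (N r : ℕ), 1 ≤ r → r < p →
      Function.Surjective (huHReduce p k 𝒳 r 1 (Nat.le_succ (N + 2)) (2 * (r : ℤ) - 1)))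
    (n : ℕ) (t : KZero (thickening 𝒳 (n + 1)).left)
    (ht : KZero.map (specialFibreToThickening 𝒳 n) t = 0) :
    ∃ t' : KZero (thickening 𝒳 (n + 2)).left,
      KZero.map (specialFibreToThickening 𝒳 (n + 1)) t' = 0 ∧
        KZero.map (thickeningMap 𝒳 (Nat.le_succ (n + 1))) t' = t := by
  obtain ⟨ρ, ha, hb⟩ := hK p k d 𝒳 h𝒳 hp
  refine kernelTower_of_naturalSurjections p k 𝒳 (fun N => HuKernelSource p k 𝒳 1 (N + 2))
    (fun N => ρ 1 (N + 2)) (fun N => HuKernelSource.reduce 1 (Nat.le_succ (N + 2)))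
    (fun N s => ?_) (fun N t ht => ?_) (fun N s => ?_) (fun N => ?_) n t ht
  · exact (ha 1 (N + 2) (by omega) le_rfl (ρ 1 (N + 2) s)).mpr ⟨s, rfl⟩
  · exact (ha 1 (N + 2) (by omega) le_rfl t).mp ht
  · exact hb 1 (N + 2) (N + 3) le_rfl (by omega) (Nat.le_succ (N + 2)) s
  · intro y
    choose x hx using fun r : {r : ℕ // 1 ≤ r ∧ r < p} => hS N r.1 r.2.1 r.2.2 (y r)
    exact ⟨x, funext hx⟩

/-! ## Level-wise (1_K) from Hu's lifting criterion and the even lattice lemma (T) -/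

/-- **Level-wise lifting from Hu's Hodge obstruction maps and torsion-free even limits.** Granted
X. Hu's Thm. 1.2 = Prop. 11.1 (i) / Prop. 9.6 (i) (`KTheory.HuKZeroLiftingCriterion`, a claim of
arXiv:2507.12458, hypothesis `hL`) for the smooth proper model `𝒳/W(k)` of relative dimension `d` with
`d + 6 ≤ p`, and the coherent lattice statement (T) — for `1 ≤ r < d` every family
`o_N ∈ ℍ^{2r}(p^{r,1}_{r,N+2}Ω•)` compatible under the reductions and killed by a non-zero integer
vanishes — every class `y ∈ K₀(X_k)` a non-zero integer multiple of which lifts to every level lifts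
to every level (verbatim the shape consumed for `y = [E₁]`, whose multiple lifts by
`Negative.exists_int_multiple_lifts_all_levels`). Proof: `HuTowerAlgebra.levelwiseLift_of_obstructionData`
with `Ob N = ⊕_{r<d} ℍ^{2r}(p^{r,1}_{r,N+2}Ω•)`, `ob N = ob_{1,N+2}`, `red N` = the reduction.
[cite: Hu2025TruncatedWitt, Thm. 1.2, Prop. 11.1 (i), Prop. 9.6 (i)] -/
theorem levelwiseLift_of_huLiftingCriterion_of_components (hL : HuKZeroLiftingCriterion)
    (h𝒳 : IsSmoothProperModel d 𝒳) (hp : d + 6 ≤ p)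
    (hT : ∀ (r : ℕ), 1 ≤ r → r < d → ∀ (L : ℤ), L ≠ 0 →
      ∀ o : (∀ N : ℕ, huH p k 𝒳 r 1 (N + 2) (2 * (r : ℤ))),
        (∀ N, huHReduce p k 𝒳 r 1 (Nat.le_succ (N + 2)) _ (o (N + 1)) = o N) →
        (∀ N, L • o N = 0) → ∀ N, o N = 0)
    (y : KZero (specialFibre 𝒳).left)
    (hy : ∃ M : ℤ, M ≠ 0 ∧ ∀ n : ℕ, ∃ z : KZero (thickening 𝒳 (n + 1)).left,
      KZero.map (specialFibreToThickening 𝒳 n) z = M • y) (n : ℕ) :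
    ∃ z : KZero (thickening 𝒳 (n + 1)).left, KZero.map (specialFibreToThickening 𝒳 n) z = y := by
  obtain ⟨ob, ha, hb⟩ := hL p k d 𝒳 h𝒳 hp
  refine levelwiseLift_of_obstructionData p k 𝒳 (fun N => HuObstructionTarget p k 𝒳 d 1 (N + 2))
    (fun N => ob 1 (N + 2)) (fun N => HuObstructionTarget.reduce d 1 (Nat.le_succ (N + 2)))
    (fun N x hx => ?_) (fun N z => ?_) (fun N x => ?_) (fun L hL0 o ho hLo N => ?_) y hy n
  · exact (ha 1 (N + 2) (by omega) le_rfl x).mpr hx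
  · exact (ha 1 (N + 2) (by omega) le_rfl _).mp ⟨z, rfl⟩
  · exact (hb 1 (N + 2) (N + 3) le_rfl (by omega) (Nat.le_succ (N + 2)) x).symm
  · funext r
    refine hT r.1 r.2.1 r.2.2 L hL0 (fun N => o N r) (fun N => ?_) (fun N => ?_) N
    · exact congr_fun (ho N) r
    · have h := congr_fun (hLo N) r
      rwa [Pi.smul_apply] at h

/-! ## Step class lifting and the crux -/

/-- **Step class lifting from the two Hu claims and the two lattice lemmas.** For a smooth proper
model `𝒳/W(k)` of relative dimension `d`, `d + 6 ≤ p`, satisfying (S) and (T): every finite-level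
finite locally free lift `F` of a finite locally free `E₁` on `X_k` whose rational class pro-lifts has
`[F] ∈ im(K₀(X_{n+2}) → K₀(X_{n+1}))` (the hypothesis `hstep` of `Glue.liftsFormally_of_stepClassLifting`).
[cite: Hu2025TruncatedWitt, Thm. 1.2, Cor. 10.5 (i)] -/
theorem stepClassLifting_of_hu (hK : HuKZeroKernelPresentation) (hL : HuKZeroLiftingCriterion)
    (h𝒳 : IsSmoothProperModel d 𝒳) (hp : d + 6 ≤ p)
    (hS : ∀ (N r : ℕ), 1 ≤ r → r < p →
      Function.Surjective (huHReduce p k 𝒳 r 1 (Nat.le_succ (N + 2)) (2 * (r : ℤ) - 1)))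
    (hT : ∀ (r : ℕ), 1 ≤ r → r < d → ∀ (L : ℤ), L ≠ 0 →
      ∀ o : (∀ N : ℕ, huH p k 𝒳 r 1 (N + 2) (2 * (r : ℤ))),
        (∀ N, huHReduce p k 𝒳 r 1 (Nat.le_succ (N + 2)) _ (o (N + 1)) = o N) →
        (∀ N, L • o N = 0) → ∀ N, o N = 0)
    {E₁ : (specialFibre 𝒳).left.Modules} (hE₁ : IsFiniteLocallyFree E₁)
    (hξ : ∃ ξ : ContinuousKZeroRat (Ideal.span {(p : WittVector p k)}) 𝒳,
      KZeroRat.map (Crystalline.specialFibreToTower 𝒳)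
        (ContinuousKZeroRat.specialFibre (Ideal.span {(p : WittVector p k)}) 𝒳 ξ) =
        KZeroRat.of E₁ hE₁)
    (n : ℕ) (F : (thickening 𝒳 (n + 1)).left.Modules) (hF : IsFiniteLocallyFree F)
    (hFE : Nonempty ((Scheme.Modules.pullback (specialFibreToThickening 𝒳 n)).obj F ≅ E₁)) :
    ∃ y : KZero (thickening 𝒳 (n + 2)).left,
      KZero.map (thickeningMap 𝒳 (Nat.le_succ (n + 1))) y = KZero.of F hF :=
  Glue.stepClassLifting_of_levelwiseLifts_of_kernelTower (𝒳 := 𝒳) hE₁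
    (levelwiseLift_of_huLiftingCriterion_of_components 𝒳 hL h𝒳 hp hT (KZero.of E₁ hE₁)
      (Negative.exists_int_multiple_lifts_all_levels hE₁ hξ))
    (kernelTower_of_huKernelPresentation_of_components 𝒳 hK h𝒳 (by omega) hS) n F hF hFE

end Model

/-- **The crux `FormalLiftingFromClassLifting` from X. Hu's two `K₀`-claims and the two coherent
lattice lemmas** (line `hu` of the crux, assembled): granted `KTheory.HuKZeroKernelPresentation` and
`KTheory.HuKZeroLiftingCriterion` (claims of arXiv:2507.12458, Cor. 10.5 (i) and Thm. 1.2 /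
Prop. 11.1 (i) with Prop. 9.6), and granted that every model in the scope of the crux — `𝒳/W(k)`
smooth proper of relative dimension `d`, projective, `d + 6 < p`, with `p`-torsion-free `Hᵇ(𝒳, 𝒪)`
and `Hᵇ(𝒳, Ω¹)` for all `b` and `d ≤ 3 ∨ Ω¹_{𝒳/W} ≅ 𝒪^d` — satisfies the lattice statements (S) (odd
reductions onto, `1 ≤ r < p`) and (T) (even compatible families killed by a non-zero integer vanish,
`1 ≤ r < d`), the crux holds: (⋆) climbs the tower (`Glue.liftsFormally_of_stepClassLifting`) over
`stepClassLifting_of_hu`. The lattice statements are the content of X. Hu, loc. cit., §11 /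
Bloch–Esnault–Kerz 2014, Rem. 35 (degeneration of Hodge–de Rham modulo torsion, transported to the
finite-level staircase complexes under torsion-free Hodge cohomology); they are hypotheses here.
[cite: Hu2025TruncatedWitt, Thm. 1.2, Prop. 11.1 (i), Cor. 10.5 (i), Prop. 9.6] -/
theorem formalLiftingFromClassLifting_of_hu :
    KTheory.HuKZeroKernelPresentation → KTheory.HuKZeroLiftingCriterion →
    (∀ (p : ℕ) [Fact p.Prime] (k : Type) [Field k] [CharP k p] [PerfectRing k p] (d : ℕ)
      (𝒳 : SchemeOver (WittVector p k)), IsSmoothProperModel d 𝒳 →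
      Crystalline.IsProjectiveOverRing 𝒳 → d + 6 < p →
      (∀ (b : ℕ) (x : structureSheafCohomology 𝒳.left b), (p : ℤ) • x = 0 → x = 0) →
      (∀ (b : ℕ) (x : hodgeCohomologyOne 𝒳 b), (p : ℤ) • x = 0 → x = 0) →
      (d ≤ 3 ∨ Nonempty (cotangentSheaf 𝒳 ≅
        SheafOfModules.free (R := 𝒳.left.ringCatSheaf) (Fin d))) →
      ∀ (N r : ℕ), 1 ≤ r → r < p →
        Function.Surjective (KTheory.huHReduce p k 𝒳 r 1 (Nat.le_succ (N + 2)) (2 * (r : ℤ) - 1))) →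
    (∀ (p : ℕ) [Fact p.Prime] (k : Type) [Field k] [CharP k p] [PerfectRing k p] (d : ℕ)
      (𝒳 : SchemeOver (WittVector p k)), IsSmoothProperModel d 𝒳 →
      Crystalline.IsProjectiveOverRing 𝒳 → d + 6 < p →
      (∀ (b : ℕ) (x : structureSheafCohomology 𝒳.left b), (p : ℤ) • x = 0 → x = 0) →
      (∀ (b : ℕ) (x : hodgeCohomologyOne 𝒳 b), (p : ℤ) • x = 0 → x = 0) →
      (d ≤ 3 ∨ Nonempty (cotangentSheaf 𝒳 ≅
        SheafOfModules.free (R := 𝒳.left.ringCatSheaf) (Fin d))) →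
      ∀ (r : ℕ), 1 ≤ r → r < d → ∀ (L : ℤ), L ≠ 0 →
        ∀ o : (∀ N : ℕ, KTheory.huH p k 𝒳 r 1 (N + 2) (2 * (r : ℤ))),
          (∀ N, KTheory.huHReduce p k 𝒳 r 1 (Nat.le_succ (N + 2)) _ (o (N + 1)) = o N) →
          (∀ N, L • o N = 0) → ∀ N, o N = 0) →
    FormalLiftingFromClassLifting := by
  intro hK hL hS hT p _ k _ _ _ d 𝒳 h𝒳 hproj hp hO hΩ hd E₁ hE₁ hstar hξ
  exact Glue.liftsFormally_of_stepClassLifting hE₁ hstar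
    (stepClassLifting_of_hu 𝒳 hK hL h𝒳 (by omega) (hS p k d 𝒳 h𝒳 hproj hp hO hΩ hd)
      (hT p k d 𝒳 h𝒳 hproj hp hO hΩ hd) hE₁ hξ)

end

end Summit.HodgeConjecture.HodgeConjecture.Theorems.FormalLiftingFromClassLifting.HuLine
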